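import Mathlib
import Summits.ResolutionOfSingularities.ResolutionOfSingularities.Theorems.RadicialJungCleanModelsCleanLU3ArcRep
import HarnessLib

/-!
# Route `RadicialJung`, crux `CleanModels` (stmt-15917), stub `stub_cleanLU3DefectArcInfinite`: the APPROXIMANT — a `p`-th root of the
# constant-coefficient part, digit by digit (the «index gain»)

Line `Sketch` rev 20 of crux stmt-ResolutionOfSingularities-15917; lead `res-B-lead-1` g3.  OURS; nothing here proves resolution in
characteristic `p`.

`exists_approximant_of_qconst`: let `R ⊆ O` with every residue of `R` and of `O` a `p`-th power, `π` a value-generator, `Q = p^s`,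
`T = R^Q` the `Q`-constants of `R`, and `G = Ĝ(π)` a polynomial in `π` with coefficients in `T`.  If `G` is a `p`-th power to order
`π^d`, `v (G - b^p) ≤ v π ^ d` (`d ≤ Q`), then for `p L < d` there is `ĉ ∈ T[X]` with `v (ĉ(π) - b) ≤ v π ^ (L+1)`: the first `L + 1`
Teichmüller digits of `b` are `Q`-constants OF `R` — they are the `p`-th roots of the digits of `G` of index `p i ≤ p L` (uniqueness of
`Q`-constant expansions, ✓ `qconst_expansion_unique`).  This is Lemma 7.1 («index gain») of res-B-lens-5 g6's hand proof
`Cruxes/DescentPerfectToAll/CLASSA-rational-arcs-lens5.md`, algebraized.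
-/

noncomputable section

set_option linter.dupNamespace false -- mandated namespace of this single-conjunct summit

open IsLocalRing Polynomial
open Literature.AlgebraicGeometry.Resolution

namespace Summit.ResolutionOfSingularities.ResolutionOfSingularities.Theorems.RadicialJung.CleanModels

variable {K : Type} [Field K]

section Approx

variable (O : ValuationSubring K) (π : K) {p : ℕ} [hp : Fact p.Prime] [CharP K p]

/-- Tail estimate: for a polynomial `P` with coefficients in `O` and `π ∈ O`, `v (P(π) - Σ_{a<B} P_a π^a) ≤ v π ^ B`. [folklore] -/
theorem valuation_aeval_sub_sum_le (hπO : π ∈ O) {T : Subring K} (hT : T ≤ O.toSubring) (P : Polynomial T) (B : ℕ) :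
    O.valuation (aeval π P - ∑ a ∈ Finset.range B, ((P.coeff a : T) : K) * π ^ a) ≤ O.valuation π ^ B := by
  have hvπ1 : O.valuation π ≤ 1 := (O.valuation_le_one_iff _).mpr hπO
  let N := max B (P.natDegree + 1)
  have hN : P.natDegree < N := lt_of_lt_of_le (Nat.lt_succ_self _) (le_max_right _ _)
  have hPsum : aeval π P = ∑ a ∈ Finset.range N, ((P.coeff a : T) : K) * π ^ a := by
    rw [aeval_eq_sum_range' hN]
    exact Finset.sum_congr rfl fun a _ => by rw [Algebra.smul_def]; rfl
  rw [hPsum, ← Finset.sum_range_add_sum_Ico _ (le_max_left B (P.natDegree + 1)), add_sub_cancel_left]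
  refine Valuation.map_sum_le _ fun a ha => ?_
  rw [Finset.mem_Ico] at ha
  rw [map_mul, map_pow]
  calc O.valuation ((P.coeff a : T) : K) * O.valuation π ^ a ≤ 1 * O.valuation π ^ B :=
        mul_le_mul' ((O.valuation_le_one_iff _).mpr (hT (P.coeff a).2)) (pow_le_pow_right_of_le_one' hvπ1 ha.1)
    _ = O.valuation π ^ B := one_mul _

/-- The `p`-th power of an expansion is the `p`-DILATED expansion of the `p`-th powers of the digits, to every order:
`v ((Σ_{r<B} e_r π^r)^p - Σ_{a<B} [p ∣ a] e_{a/p}^p π^a) ≤ v π ^ B`. [folklore] -/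
theorem valuation_pow_sub_dilate_le (hπO : π ∈ O) (e : ℕ → K) (he : ∀ r, e r ∈ O) (B : ℕ) :
    O.valuation ((∑ r ∈ Finset.range B, e r * π ^ r) ^ p -
      ∑ a ∈ Finset.range B, (if p ∣ a then e (a / p) ^ p else 0) * π ^ a) ≤ O.valuation π ^ B := by
  classical
  have hvπ1 : O.valuation π ≤ 1 := (O.valuation_le_one_iff _).mpr hπO
  have hp0 : 0 < p := hp.out.pos
  rw [sum_pow_char p]
  -- the dilated sum is the sum over `r` with `p r < B`
  have hdil : (∑ a ∈ Finset.range B, (if p ∣ a then e (a / p) ^ p else 0) * π ^ a) =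
      ∑ r ∈ (Finset.range B).filter (fun r => p * r < B), e r ^ p * π ^ (p * r) := by
    have himg : (Finset.range B).filter (fun a => p ∣ a) = ((Finset.range B).filter (fun r => p * r < B)).image (fun r => p * r) := by
      ext a
      simp only [Finset.mem_filter, Finset.mem_range, Finset.mem_image]
      constructor
      · rintro ⟨haB, ⟨r, rfl⟩⟩
        exact ⟨r, ⟨lt_of_le_of_lt (Nat.le_mul_of_pos_left r hp0) haB, haB⟩, rfl⟩
      · rintro ⟨r, ⟨-, hr⟩, rfl⟩
        exact ⟨hr, dvd_mul_right _ _⟩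
    rw [← Finset.sum_filter_add_sum_filter_not (Finset.range B) (fun a => p ∣ a)]
    have hzero : (∑ a ∈ (Finset.range B).filter (fun a => ¬ p ∣ a), (if p ∣ a then e (a / p) ^ p else 0) * π ^ a) = 0 :=
      Finset.sum_eq_zero fun a ha => by rw [if_neg (Finset.mem_filter.mp ha).2, zero_mul]
    rw [hzero, add_zero, himg, Finset.sum_image (fun r _ r' _ h => Nat.eq_of_mul_eq_mul_left hp0 h)]
    refine Finset.sum_congr rfl fun r _ => ?_
    rw [if_pos (dvd_mul_right _ _), Nat.mul_div_cancel_left _ hp0]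
  rw [hdil, ← Finset.sum_filter_add_sum_filter_not (Finset.range B) (fun r => p * r < B)]
  have e1 : (∑ r ∈ (Finset.range B).filter (fun r => p * r < B), (e r * π ^ r) ^ p) =
      ∑ r ∈ (Finset.range B).filter (fun r => p * r < B), e r ^ p * π ^ (p * r) :=
    Finset.sum_congr rfl fun r _ => by rw [mul_pow, ← pow_mul, mul_comm r p]
  rw [e1, add_sub_cancel_left]
  refine Valuation.map_sum_le _ fun r hr => ?_
  obtain ⟨-, hr⟩ := Finset.mem_filter.mp hr
  rw [mul_pow, ← pow_mul, map_mul, map_pow, map_pow]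
  calc O.valuation (e r) ^ p * O.valuation π ^ (r * p) ≤ 1 * O.valuation π ^ B :=
        mul_le_mul' (pow_le_one₀ zero_le ((O.valuation_le_one_iff _).mpr (he r)))
          (pow_le_pow_right_of_le_one' hvπ1 (by rw [mul_comm]; exact not_lt.mp hr))
    _ = O.valuation π ^ B := one_mul _

/-- **The approximant.**  See the module docstring. [folklore] -/
theorem exists_approximant_of_qconst (hπO : π ∈ O) (hπ0 : π ≠ 0) (hvπ : O.valuation π < 1)
    (hπ : ∀ x : K, O.valuation x < 1 → O.valuation x ≤ O.valuation π)
    (hperfO : ∀ b : K, b ∈ O → ∃ t : K, t ∈ O ∧ O.valuation (b - t ^ p) < 1)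
    {R : Subring K} (hRO : R ≤ O.toSubring) (hperfR : ∀ b : K, b ∈ R → ∃ t : K, t ∈ R ∧ O.valuation (b - t ^ p) < 1)
    (s : ℕ) (Ĝ : Polynomial (R.map (iterateFrobenius K p s))) (b : K) (hb : b ∈ O) (d L : ℕ) (hLd : p * L < d) (hdQ : d ≤ p ^ s)
    (hG : O.valuation (aeval π Ĝ - b ^ p) ≤ O.valuation π ^ d) :
    ∃ ĉ : Polynomial (R.map (iterateFrobenius K p s)), O.valuation (aeval π ĉ - b) ≤ O.valuation π ^ (L + 1) := by
  classical
  have hTR : R.map (iterateFrobenius K p s) ≤ R := map_iterateFrobenius_le R s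
  have hTO : R.map (iterateFrobenius K p s) ≤ O.toSubring := hTR.trans hRO
  have hvπ1 : O.valuation π ≤ 1 := (O.valuation_le_one_iff _).mpr hπO
  have hvπpos : 0 < O.valuation π := zero_lt_iff.mpr ((Valuation.ne_zero_iff _).mpr hπ0)
  have hanti : ∀ {i j : ℕ}, i ≤ j → O.valuation π ^ j ≤ O.valuation π ^ i := fun hij => pow_le_pow_right_of_le_one' hvπ1 hij
  have h2p : 2 ≤ p := hp.out.two_le
  have hLd' : L + 1 ≤ d := by nlinarith
  have hQ1 : 1 ≤ p ^ s := Nat.one_le_pow _ _ hp.out.pos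
  -- (1) `Q`-constant expansion of `b` to order `d`
  obtain ⟨eb, heb, hbexp⟩ := exists_qconst_expansion O π hπ0 hπ hperfO s d b hb
  have hebO : ∀ r, eb r ∈ O := fun r => by obtain ⟨t, ht, h⟩ := heb r; rw [h]; exact O.pow_mem ht _
  -- (2) the two expansions of `b^p ≈ G` to order `d`: digits of `Ĝ`, and the dilated digits of `b`
  let eG : ℕ → K := fun a => ((Ĝ.coeff a : R.map (iterateFrobenius K p s)) : K)
  let eB : ℕ → K := fun a => if p ∣ a then eb (a / p) ^ p else 0
  have heGR : ∀ a, ∃ r : K, r ∈ R ∧ r ^ p ^ s = eG a := fun a => (mem_map_iterateFrobenius_iff R s _).mp (Ĝ.coeff a).2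
  have heG : ∀ a, ∃ t : K, t ∈ O ∧ eG a = t ^ p ^ s := fun a => by
    obtain ⟨r, hr, hra⟩ := heGR a
    exact ⟨r, hRO hr, hra.symm⟩
  have heB : ∀ a, ∃ t : K, t ∈ O ∧ eB a = t ^ p ^ s := fun a => by
    by_cases ha : p ∣ a
    · obtain ⟨t, ht, hta⟩ := heb (a / p)
      refine ⟨t ^ p, O.pow_mem ht _, ?_⟩
      simp only [eB, if_pos ha, hta, ← pow_mul, mul_comm (p ^ s) p]
    · exact ⟨0, O.zero_mem, by simp only [eB, if_neg ha, zero_pow (pow_ne_zero _ hp.out.ne_zero)]⟩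
  have hagree : O.valuation (∑ a ∈ Finset.range d, eG a * π ^ a - ∑ a ∈ Finset.range d, eB a * π ^ a) ≤ O.valuation π ^ d := by
    have h1 := valuation_aeval_sub_sum_le O π hπO hTO Ĝ d
    have h2 := valuation_pow_sub_dilate_le O π hπO eb hebO d
    have h3 : O.valuation (b ^ p - (∑ r ∈ Finset.range d, eb r * π ^ r) ^ p) ≤ O.valuation π ^ d := by
      rw [← sub_pow_char b, map_pow]
      exact pow_le_of_le_one zero_le (hbexp.trans (pow_le_one₀ zero_le hvπ1)) hp.out.ne_zero |>.trans hbexp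
    have e : ∑ a ∈ Finset.range d, eG a * π ^ a - ∑ a ∈ Finset.range d, eB a * π ^ a =
        -(aeval π Ĝ - ∑ a ∈ Finset.range d, eG a * π ^ a) + (aeval π Ĝ - b ^ p) +
          (b ^ p - (∑ r ∈ Finset.range d, eb r * π ^ r) ^ p) +
          ((∑ r ∈ Finset.range d, eb r * π ^ r) ^ p - ∑ a ∈ Finset.range d, eB a * π ^ a) := by ring
    rw [e]
    refine (Valuation.map_add _ _ _).trans (max_le ((Valuation.map_add _ _ _).trans (max_le
      ((Valuation.map_add _ _ _).trans (max_le ?_ hG)) h3)) h2)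
    rw [Valuation.map_neg]; exact h1
  have huniq := qconst_expansion_unique O π hπO hπ0 hπ s d hdQ eG eB heG heB hagree
  -- (3) the digits `p i`, `i ≤ L`
  have hdig : ∀ i, i < L + 1 → O.valuation (eG (p * i) - eb i ^ p) ≤ O.valuation π ^ p ^ s := by
    intro i hi
    have hpi : p * i < d := lt_of_le_of_lt (Nat.mul_le_mul_left p (Nat.lt_succ_iff.mp hi)) hLd
    have := huniq (p * i) hpi
    simp only [eB, if_pos (dvd_mul_right p i), Nat.mul_div_cancel_left _ hp.out.pos] at this
    exact this
  -- (4) `p`-th roots of the digits of `Ĝ` inside `T`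
  have hroot : ∀ i, ∃ t : K, t ∈ R ∧ O.valuation (eG (p * i) - t ^ p ^ (s + 1)) < 1 := fun i =>
    exists_sub_pow_pow_lt_subring O R hperfR (s + 1) (eG (p * i)) (hTR (Ĝ.coeff (p * i)).2)
  choose t htR hvt using hroot
  have htT : ∀ i, t i ^ p ^ s ∈ R.map (iterateFrobenius K p s) := fun i => (mem_map_iterateFrobenius_iff R s _).mpr ⟨t i, htR i, rfl⟩
  have hclose : ∀ i, i < L + 1 → O.valuation (t i ^ p ^ s - eb i) ≤ O.valuation π ^ p ^ s := by
    intro i hi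
    obtain ⟨t', ht', het'⟩ := heb i
    rw [het']
    refine valuation_qconst_sub_qconst O π hπ s (t i) t' ?_
    -- `v ((tᵢ^Q)^p - ebᵢ^p) < 1`, hence `v (tᵢ^Q - ebᵢ) < 1`
    have hp1 : O.valuation ((t i ^ p ^ s - eb i) ^ p) < 1 := by
      rw [sub_pow_char, ← pow_mul, ← pow_succ]
      have e : t i ^ p ^ (s + 1) - eb i ^ p = -(eG (p * i) - t i ^ p ^ (s + 1)) + (eG (p * i) - eb i ^ p) := by ring
      rw [e]
      refine lt_of_le_of_lt (Valuation.map_add _ _ _) (max_lt ?_ ?_)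
      · rw [Valuation.map_neg]; exact hvt i
      · exact lt_of_le_of_lt (hdig i hi) (pow_lt_one₀ zero_le hvπ (by positivity))
    rw [← het']
    by_contra hge
    push Not at hge
    rw [map_pow] at hp1
    exact absurd (one_le_pow₀ (M₀ := O.ValueGroup) hge) (not_le.mpr hp1)
  -- (5) the approximant
  refine ⟨∑ i ∈ Finset.range (L + 1), Polynomial.C (⟨t i ^ p ^ s, htT i⟩ : R.map (iterateFrobenius K p s)) * Polynomial.X ^ i, ?_⟩
  have hĉ : aeval π (∑ i ∈ Finset.range (L + 1), Polynomial.C (⟨t i ^ p ^ s, htT i⟩ : R.map (iterateFrobenius K p s)) *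
      Polynomial.X ^ i) =
      ∑ i ∈ Finset.range (L + 1), t i ^ p ^ s * π ^ i := by
    rw [map_sum]
    refine Finset.sum_congr rfl fun i _ => ?_
    rw [map_mul, map_pow, aeval_X, aeval_C]; rfl
  rw [hĉ]
  have e : (∑ i ∈ Finset.range (L + 1), t i ^ p ^ s * π ^ i) - b =
      (∑ i ∈ Finset.range (L + 1), (t i ^ p ^ s - eb i) * π ^ i) +
        -((b - ∑ r ∈ Finset.range d, eb r * π ^ r) + ∑ r ∈ Finset.Ico (L + 1) d, eb r * π ^ r) := by
    have hsplit : ∑ r ∈ Finset.range d, eb r * π ^ r =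
        ∑ r ∈ Finset.range (L + 1), eb r * π ^ r + ∑ r ∈ Finset.Ico (L + 1) d, eb r * π ^ r :=
      (Finset.sum_range_add_sum_Ico _ hLd').symm
    have hA : ∑ i ∈ Finset.range (L + 1), (t i ^ p ^ s - eb i) * π ^ i =
        ∑ i ∈ Finset.range (L + 1), t i ^ p ^ s * π ^ i - ∑ i ∈ Finset.range (L + 1), eb i * π ^ i := by
      rw [← Finset.sum_sub_distrib]
      exact Finset.sum_congr rfl fun i _ => by ring
    rw [hA, hsplit]
    ring
  rw [e]
  refine (Valuation.map_add _ _ _).trans (max_le ?_ ?_)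
  · refine Valuation.map_sum_le _ fun i hi => ?_
    rw [map_mul, map_pow]
    calc O.valuation (t i ^ p ^ s - eb i) * O.valuation π ^ i ≤ O.valuation π ^ p ^ s * 1 :=
          mul_le_mul' (hclose i (Finset.mem_range.mp hi)) (pow_le_one₀ zero_le hvπ1)
      _ = O.valuation π ^ p ^ s := mul_one _
      _ ≤ O.valuation π ^ (L + 1) := hanti (hLd'.trans hdQ)
  · rw [Valuation.map_neg]
    refine (Valuation.map_add _ _ _).trans (max_le (hbexp.trans (hanti hLd')) ?_)
    refine Valuation.map_sum_le _ fun r hr => ?_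
    rw [Finset.mem_Ico] at hr
    rw [map_mul, map_pow]
    calc O.valuation (eb r) * O.valuation π ^ r ≤ 1 * O.valuation π ^ (L + 1) :=
          mul_le_mul' ((O.valuation_le_one_iff _).mpr (hebO r)) (hanti hr.1)
      _ = O.valuation π ^ (L + 1) := one_mul _

end Approx

end Summit.ResolutionOfSingularities.ResolutionOfSingularities.Theorems.RadicialJung.CleanModels

end
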